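import Mathlib
import HarnessLib
import HarnessLib.Audit
import Summits.SmoothPoincare4.Statement
import Literature.Topology.FourManifolds.HomotopySpheres
import Literature.Topology.FourManifolds.TwistedSpheres

/-!
Route: EuclideanOrigami

DORMANT since 2026-09-04T19:05:37Z (reconciler: no traction for 5 d (last activity statement-checked at 2026-08-30T17:57:53Z); parked, not closed — `ledger route dormant route-SmoothPoincare4-EuclideanOrigami --off` to reactivate) — unstaffed, not closed; items shared with open routes are served there. `ledger route dormant <id> --off` reactivates.

# Route EuclideanOrigami — fake 4-balls are Euclidean origami — immersed balls in ℝ⁴, a crease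
ladder (no triple points ⇒ unit), Schoenflies to finish

Realises idea card euclidean-origami-fake-balls (spine). For a homotopy 4-sphere Σ and a smooth
chart ball e : ℝ⁴ ↪ Σ, the FAKE BALL
Δ_e := Σ ∖ e(B̊⁴) is compact, contractible, ∂Δ_e = e(S³). An IMMERSED FAKE BALL is a map F : Σ → ℝ⁴
that is a local diffeomorphism at
every point of Δ_e; its CREASE is the immersed 3-sphere F ∘ e|S³ : S³ ↬ ℝ⁴. Such F exist for every Σ
and e (Hirsch–Poénaru–Phillips,
support item HirschPoenaruImmersion) and a crease that is EMBEDDED forces Δ_e ↪ ℝ⁴ (support item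
CoveringLemma, sheet counting).
It suffices to show X = X1 ∧ X2 ∧ (B): (X1 = NoTripleRung) an immersed fake ball whose crease has no
triple points (every fibre of
F ∘ e|S³ has ≤ 2 points) is a Schoenflies ball: Δ_e admits an injective immersion into ℝ⁴; (X2 =
CreaseCollapse) every fake ball admits an
immersion whose crease has no triple points; (B = Schoenflies) the smooth 4-dimensional Schoenflies
conjecture. X1 ∧ X2 say every Δ_e
embeds in ℝ⁴ (= every Σ is invertible under #, = conjunct (A) of route SchoenfliesSplit, support
item PuncturedEmbeds), and with (B),
Palais' disc theorem (proved in tree) and Cerf Γ₄ = 0 (named fact) Σ is a twisted sphere hence S⁴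
(support item SchoenfliesGlue).
SPC4 ⇒ X1 ∧ X2 trivially, so X1 ∧ X2 has zero slack in total; the split is along a NEW complexity —
the multiple-point depth of the
crease of one flexible object (an immersed ball, unique up to regular homotopy) — with recognition
(X1) and collapse (X2) halves.
Lean: `(∀ (S : Literature.Topology.FourManifolds.HomotopySphere 4) (e : EuclideanSpace ℝ (Fin 4) →
S.carrier) (F : S.carrier → EuclideanSpace ℝ (Fin 4)), Manifold.IsSmoothEmbedding (𝓡 4) (𝓡 4) ∞ e →
(∀ x, x ∉ e '' Metric.ball (0 : EuclideanSpace ℝ (Fin 4)) 1 → IsLocalDiffeomorphAt (𝓡 4) (𝓡 4) ∞ F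
x) → (∀ u v w : EuclideanSpace ℝ (Fin 4), ‖u‖ = 1 → ‖v‖ = 1 → ‖w‖ = 1 → F (e u) = F (e v) → F (e v)
= F (e w) → u = v ∨ v = w ∨ u = w) → ∃ G : S.carrier → EuclideanSpace ℝ (Fin 4), (∀ x, x ∉ e ''
Metric.ball (0 : EuclideanSpace ℝ (Fin 4)) 1 → IsLocalDiffeomorphAt (𝓡 4) (𝓡 4) ∞ G x) ∧ Set.InjOn G
(e '' Metric.ball (0 : EuclideanSpace ℝ (Fin 4)) 1)ᶜ) ∧ (∀ (S :
Literature.Topology.FourManifolds.HomotopySphere 4) (e : EuclideanSpace ℝ (Fin 4) → S.carrier),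
Manifold.IsSmoothEmbedding (𝓡 4) (𝓡 4) ∞ e → ∃ F : S.carrier → EuclideanSpace ℝ (Fin 4), (∀ x, x ∉ e
'' Metric.ball (0 : EuclideanSpace ℝ (Fin 4)) 1 → IsLocalDiffeomorphAt (𝓡 4) (𝓡 4) ∞ F x) ∧ ∀ u v w
: EuclideanSpace ℝ (Fin 4), ‖u‖ = 1 → ‖v‖ = 1 → ‖w‖ = 1 → F (e u) = F (e v) → F (e v) = F (e w) → u
= v ∨ v = w ∨ u = w) ∧ Literature.Topology.FourManifolds.SmoothSchoenfliesConjectureFour`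

## Assembly
Pure logic plus the packaging of Theorems/PICReduction.lean, PROVED in the planner's Sketch.lean
(axioms propext / Classical.choice /
Quot.sound only): CreaseCollapse supplies for each (S, e) an immersed fake ball with
triple-point-free crease, NoTripleRung turns it into an
injective immersion of Δ_e, SchoenfliesGlue (with the Schoenflies crux and the named fact Cerf Γ₄ =
0, kept as an explicit antecedent
exactly as in SchoenfliesSplit's proved Assembly3) gives ∀ S : HomotopySphere 4, S ≅ S⁴, and
`Literature.SPC4.smoothPoincare4_of_forall_homotopySphere`
with the proved facts `compactSpace_of_homotopyEquiv_sphere_four_holds` /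
`isOrientable_of_homotopyEquiv_sphere_four_holds` yields SmoothPoincare4.

Rationale: WHY THIS LINE. Equidimensional immersion theory makes EXISTENCE free and flexible: Δ_e is
parallelisable with non-empty boundary, so it immerses in ℝ⁴
and Imm(Δ_e, ℝ⁴) ≃ Map(Δ_e, GL⁺₄) is connected (Hirsch1959, Poenaru1962, Phillips1967); the crease
always has the Smale invariant of the
round sphere (Hughes1992; Kinjo2015 Thm 2.2: normal degree χ(Δ) = 1, Hirzebruch defect −3σ(Δ) = 0)
and is null-bordant as an immersion
(it bounds F), so every classical invariant of the crease vanishes and all exoticness of Σ sits in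
HOW the crease must self-intersect.
RIGIDITY is cheap and localised: an embedded crease gives Δ_e ↪ ℝ⁴ by sheet counting over the
complement of an embedded S³ ⊂ ℝ⁴ (the
topological Schoenflies theorem needed for the count is PROVED in tree,
`exists_homeomorph_image_eq_sphereEquator_holds`), a round crease
gives Δ_e ≅ B⁴ (support RoundCreaseStandard). Between "embedded" and "arbitrary" lies a finite
stratified picture — double surface, triple
curves, quadruple points of a generic S³ ↬ ℝ⁴ with sheet multiplicities on the regions — and the
imported area is codimension-one
immersion theory: Blank's extension calculus for immersed circles bounding immersed discs
(Francis1970, Bailey1975, Mcintyre1997) and its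
higher-dimensional form (Pappas1996), multiple-point invariants of immersed 3-manifolds in ℝ⁴
(Freedman1978, Eccles1980, Eccles1981,
EkholmTakase2010), none of which has been pointed at homotopy 4-balls. No prior route uses
immersions of the punctured sphere: SchoenfliesSplit
files the endpoint (A) with no mechanism, WrinkleUnlinking uses FOLDED degree-one maps of the closed
Σ (its unlinking lemma is the fold
cousin of CoveringLemma), developing-map cards use the closed Σ, which must fold; the negatives
index is empty.

RANKED CRUXES. #2 NoTripleRung (crux) — (card Q3, "first rung") for every homotopy 4-sphere S,
smooth embedding e : ℝ⁴ → S and F : S → ℝ⁴ that is a local diffeomorphism at every point outside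
e(B̊⁴): if the crease F ∘ e|S³ has no triple points (F (e u) = F (e v) = F (e w) with ‖u‖ = ‖v‖ =
‖w‖ = 1 forces two of u, v, w to coincide), then Δ_e admits an injective immersion G into ℝ⁴ (Δ_e is
a Schoenflies ball, S is invertible). [deps: CoveringLemma] [difficulty: open-problem] (why it might
fail: A double-point-only crease fixes the regions of ℝ⁴ ∖ F(e(S³)) and the local sheet rules, not
the monodromy of sheets over regions with π₁ ≠ 1; a connected cover there may assemble a fake ball
sharing its crease with B⁴ (4D Milnor doodle), or the rung may contain Schoenflies-hard cases.)
[Pappas1996, Francis1970, Mcintyre1997, Freedman1978, Eccles1980]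
#3 CreaseCollapse (crux) — (complexity-collapse half) for every homotopy 4-sphere S and smooth
embedding e : ℝ⁴ → S there is F : S → ℝ⁴, a local diffeomorphism at every point outside e(B̊⁴),
whose crease F ∘ e|S³ has no triple points. [deps: HirschPoenaruImmersion] [difficulty:
open-problem] (why it might fail: Imm(Δ,ℝ⁴) is connected, but no move is known that removes triple
curves of the crease while keeping the immersion extendable over Δ (the relative equidimensional
h-principle fails: Blank); the minimal crease of a non-unit may need triple or quadruple points.)
[Hirsch1959, Poenaru1962, Phillips1967, Hughes1992, Kinjo2015, Eccles1981]
#4 Schoenflies (crux) — the smooth 4-dimensional Schoenflies conjecture (Literature def, equator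
form; shared with route SchoenfliesSplit item (B)): every smoothly embedded S³ ⊂ S⁴ is carried onto
the equator by a diffeomorphism of S⁴. [difficulty: open-problem] (why it might fail: Open since
Mazur1959; known only for genus ≤ 2 embeddings (Scharlemann1984) and special families
(Gompf1991Killing); knotted 3-balls (BudneyGabai2019) kill the relative form, so (B) may fail even
if SPC4 holds.) [Mazur1959, Kirby1989, Scharlemann1984, Gompf1991Killing, BudneyGabai2019]
#9 CoveringLemma (support) — (card lemma (3), sheet counting) if F is a local diffeomorphism at
every point outside e(B̊⁴) and the crease F ∘ e is injective on the unit sphere, then F is injective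
on Δ_e = (e(B̊⁴))ᶜ. Proof: the sheet number of F|int Δ_e is locally constant off the embedded
3-sphere F(e(S³)) and vanishes near infinity, so F(int Δ_e) is the bounded complementary region,
over which F is a finite connected cover of a simply connected open set (topological Schoenflies,
proved in tree: `Literature.Topology.FourManifolds.exists_homeomorph_image_eq_sphereEquator_holds`
with `isLocallyFlat_of_isSmoothEmbedding`), hence injective. [difficulty: L] [Brown1960,
Rushing1973, GabaiNaylorSchwartz2025]
#9 RoundCreaseStandard (support) — (card: "B⁴ iff the boundary can be round") under Cerf Γ₄ = 0 in
twisted-sphere form: if some immersed fake ball has its crease inside a round sphere (dist (F (e u))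
c = r for ‖u‖ = 1; then r > 0 and F ∘ e|S³ is a covering of the round S³, hence injective), then by
CoveringLemma F(Δ_e) is the closed round ball, Δ_e ≅ D⁴ compatibly with e, S is a twisted sphere and
S ≅ S⁴. [difficulty: XL] [Cerf1968, Palais1960, KervaireMilnor1963]
#9 SchoenfliesGlue (support) — (glue to the summit form, classical) under Cerf Γ₄ = 0: if every fake
ball Δ_e admits an injective immersion G into ℝ⁴ and the smooth Schoenflies conjecture holds, then
every homotopy 4-sphere is diffeomorphic to S⁴. Proof: σ⁻¹ ∘ G ∘ e|S³ is a smooth S³ ⊂ S⁴; G(int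
Δ_e) is exactly the bounded complementary region (clopen argument); Schoenflies in ball form on the
far side of the north pole (tree: `SmoothSchoenfliesConjectureFour.exists_ball_not_mem`) makes
G(Δ_e) a smooth closed 4-ball, so Δ_e ≅ D⁴ and S = e(D⁴) ∪ Δ_e is a twisted sphere
(`Literature.Topology.FourManifolds.IsTwistedSphere`); Cerf gives S ≅ S⁴. [difficulty: XL]
[Cerf1968, Palais1960, Kirby1989, Mazur1959]
#9 PuncturedEmbeds (support) — (link to SchoenfliesSplit (A), verbatim its conclusion) if every fake
ball Δ_e admits an injective immersion into ℝ⁴ then every punctured homotopy 4-sphere S ∖ {p}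
smoothly embeds in ℝ⁴: choose e with e 0 = p; an immersion injective on the compact Δ_e is injective
on S ∖ e(closed ball of radius 1 − ε) for some ε > 0; precompose with a radial diffeomorphism S ∖
{p} ≅ S ∖ e(B̄(0, 1 − ε)) supported in the chart; an injective local diffeomorphism is a smooth
embedding. [difficulty: L] [Palais1960, Hirsch1976]
#9 HirschPoenaruImmersion (support) — (card fact (1): the arena is non-empty for EVERY Σ) every fake
ball immerses in ℝ⁴: for every homotopy 4-sphere S and smooth embedding e : ℝ⁴ → S there is F : S →
ℝ⁴ that is a local diffeomorphism at every point outside e(B̊⁴). In print: an open parallelisable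
n-manifold immerses (= submerses) in ℝⁿ (Hirsch1959 for immersions in codim ≥ 1 plus Poenaru1962
handle-by-handle in codim 0; Phillips1967 Thm A for submersions of open manifolds), applied to the
open set S ∖ e(B̄(0, 1/2)) ⊂ S ∖ {e 0}, which is contractible hence parallelisable. Provable once
that h-principle is vendored as a named fact (cite item filed); implied by CreaseCollapse.
[difficulty: XL] [Hirsch1959, Poenaru1962, Phillips1967]
#9 BoundaryDeterminesBall (support) — (card Q1, the "4D Milnor doodle", filed as an unstaffed side
statement; with "every crease also bounds an immersed B⁴" it would be a Schoenflies-free assembly,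
see Not decomposed yet) two immersed fake balls with the same crease GERM — F (e u) = F' (e' u) for
1 ≤ ‖u‖ ≤ 1 + δ — belong to diffeomorphic homotopy spheres. [difficulty: open-problem] [Francis1970,
Pappas1996, Bailey1975]
#9 RoundModel (support) — (sanity / non-vacuity of the shared hypothesis pattern) on the round S⁴
there are a smooth embedding e : ℝ⁴ → S⁴ and F : S⁴ → ℝ⁴, a local diffeomorphism at every point
outside e(B̊⁴) and injective there, whose crease is the unit round sphere: e = inverse stereographic
projection from the north pole (unit sphere ↦ equator), F = stereographic projection from the south
pole (junk value at the south pole), F ∘ e = inversion u ↦ u/‖u‖² on the collar. A refuter who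
cannot build it has found a definition leak in every item. [difficulty: provable-now] [Lee2013,
Hirsch1976]

TWO-LAYER PLAN. Foreseen glued splits (none filed now, k ≤ 3, depth 1). NoTripleRung ⇐
SimplyConnectedRegionsRung (all complementary regions of the crease
simply connected ⇒ every sheet cover is trivial and the origami is a boundary-connected sum of
closures of regions ⇒ Δ_e embeds) →
MonodromyRung (double-point-only crease, arbitrary regions: the connected covers over the n = 2
strata close up only trivially) → NoTripleRung.
CreaseCollapse ⇐ HirschPoenaruImmersion (exists) → TripleCurveElimination (any immersed fake ball is
regularly homotopic THROUGH immersed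
fake balls to one whose crease has no triple curves: finger/Whitney-type moves on the crease that
extend over a collar) → CreaseCollapse.
Schoenflies: not split here (route SchoenfliesSplit owns it).

KILL CRITERIA. (a) NoTripleRung refuted by an explicit immersed fake ball with double-point-only
crease that does not embed = an exotic (non-invertible)
homotopy 4-sphere = ¬SPC4: decisive, close refuted together with the problem's positive side. (b)
NoTripleRung shown to CONTAIN the
Schoenflies problem with no extra structure (every smooth S³ ⊂ S⁴ arises as a region boundary whose
ball-ness the rung needs): demote it to
support, promote MonodromyRung/SimplyConnectedRegionsRung, keep the route only if CreaseCollapse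
retains content. (c) CreaseCollapse shown
EQUIVALENT to "Δ_e embeds" by a cheap triple-point-removal trick (the ladder has no rungs): close
superseded --by route-SmoothPoincare4-SchoenfliesSplit,
hand CoveringLemma/RoundCreaseStandard/PuncturedEmbeds to it as supports. (d) Schoenflies refuted (a
non-standard smooth S³ ⊂ S⁴): the
assembly dies; pivot to the Schoenflies-free doodle assembly (BoundaryDeterminesBall ∧
CreaseBoundsStandardBall → SPC4, see Not decomposed
yet) by --restate, or close refuted:Schoenflies if that pair cannot be typed with content. (e)
RoundModel unprovable (definition leak in the
shared hypothesis pattern): repair every item by --restate, not fatal. (f) SchsplitPuncturedEmbeds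
(stmt-SmoothPoincare4-0371) or
SchsplitInvertible proved elsewhere moots X1 ∧ X2 (they become corollaries); the route then closes
superseded.

NOT DECOMPOSED YET. The crease complexity c(Δ) (lexicographic count of quadruple points,
triple-curve components, genus of the double surface, minimised over
immersions) and the generic-immersion strata it needs — no definition request until NoTripleRung is
staffed; the card's analytic rungs
IRON (mean-convex immersed crease ⇒ unit; no Mathlib mean curvature for immersed hypersurfaces),
(2a) pseudoconvex crease ⇒ B⁴ (Stein
filling, route SymplecticCap's facts) and (2b) scal ≥ 0 with flat round collar ⇒ B⁴ (positive mass);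
the Schoenflies-free DOODLE ASSEMBLY
BoundaryDeterminesBall ∧ CreaseBoundsStandardBall (every crease germ of an immersed fake ball also
bounds an immersed B⁴, through the
inversion u ↦ u/‖u‖² on the collar) → SPC4, of which only the first conjunct is filed (support); the
negative side ¬NoTripleRung (file with
a rank only if a refuter produces a candidate monodromy); quadruple-point and triple-curve parity of
creases (all bordism invariants vanish
since the crease bounds F — recorded, not filed).

CHEAPEST FALSIFIER. (1) LOOKUP: read Pappas1996 (TAMS 348, higher-dimensional Blank extension
theory; paywalled here, acq-01956 open) — if its extension
criterion, specialised to a triple-point-free f : S³ ↬ ℝ⁴, already enumerates the extension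
manifolds N and shows each embeds (or exhibits
two with different N), NoTripleRung is known (demote) or dead. (2) HAND CHECK (done informally by
the planner, standard): the one-finger-move
crease (double surface one S², regions with sheet numbers 0/1/2, all simply connected) bounds only
B⁴ — consistent; the first real test is a
crease whose sheet-number-2 region is S¹ × B³ ⊂ ℝ⁴: does the connected double cover close up with
the other sheets to a homotopy ball, and
does that ball embed? A refuter can settle this on paper in an hour. (3) LEAK TEST: prove RoundModel
(stereographic charts; Mathlib
`stereographic'`); failure means the hypothesis pattern `∀ x ∉ e '' ball 0 1, IsLocalDiffeomorphAt …
F x` is mis-typed in every item.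
I ran (2) for the finger-move crease only; (1) blocked on acquisition; (3) not run in Lean (the
pattern elaborates, Sketch.lean rc 0).

NUMBERS. Imm[S³, ℝ⁴] ≅ π₃(V₄,₃) ≅ π₃(SO₄) ≅ ℤ ⊕ ℤ and imm(3,4) ≅ π₃ˢ ≅ ℤ/24 (Kinjo2015 §1, read pp.
3–4); Smale invariant of an immersion
f : S³ ↬ ℝ⁴ bounding a singular Seifert surface F : V → ℝ⁴: Ω(f) = (ndeg f − 1, (−hdef f − 2(ndeg f
− 1))/4) with hdef f = −3σ(V) − #Σ²(F)
and, for F an immersion, ndeg f = χ(V) (Kinjo2015 Thm 2.2 / Rem 2.3 after Hughes1992,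
EkholmTakase2010); for V = Δ a homotopy ball:
χ = 1, σ = 0, #Σ² = 0, so Ω(crease) = (0, 0) = Ω(round S³) for EVERY immersed fake ball — the crease
is regularly homotopic to the round
sphere and null-bordant, carrying no classical invariant. Sheet numbers across a crease sheet change
by ±1; depth of a double-point-only
crease is unbounded (nested sheets). Γ₄ = 0 (Cerf1968). Items at open: 11 (3 cruxes, 7 supports, 1
assembly).

DEFINITION REQUESTS. None needed for the filed items (chart balls = `Manifold.IsSmoothEmbedding` of
ℝ⁴, immersions = pointwise `IsLocalDiffeomorphAt`,
creases = F ∘ e on the unit sphere). Deferred: `IsSelfTransverseImmersion` / multiple-point strata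
of a generic S³ ↬ ℝ⁴ and the crease
complexity c(Δ) (topic Literature/Topology/Immersions) — to be requested when NoTripleRung is
staffed. Cite fact wanted (filed as a cite
item after open): Phillips1967 Thm A / Hirsch1959–Poenaru1962 — an open parallelisable n-manifold
immerses in ℝⁿ (equidimensional
h-principle), the hypothesis that makes HirschPoenaruImmersion provable.

Novelty: Searches (2026-08-15): `lit search` local/hybrid — searchd unavailable (rc 75, logged, retried ×3);
`lit search --source crossref`
"extending immersions of spheres to immersions of discs" (10 rows, all minimal-immersion noise),
"Francis extensions to the disk of
properly nested plane immersions" (5: Francis1970, Bailey1975, Farias 1974, Scott Carter 1991 — all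
dimension 2), "Eccles multiple points
of codimension one immersions" (6: Eccles1980, Eccles1981, Szűcs 2003, Takase 2011), "Freedman
quadruple points" (doi:10.1007/bf02566085),
"Pappas extensions of codimension one immersions" (zbMATH zbl:0870.57044, review read: extensions of
transversal codim-1 immersions
f : Mᵐ → Wᵐ⁺¹ over (m+1)-manifolds N with ∂N = M — the extension manifold is an OUTPUT); `lit read
arxiv:1309.6526` (Kinjo2015, READ
pp. 2–4, 13); `lit read doi:10.1090/s0002-9947-96-01572-3` (Pappas1996: paywalled, AMS 429,
acq-01956); `lit galaxy search --star all`
"extensions of codimension one immersions" (0), "immersed circle bounds an immersed disk" (0),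
"extends to an immersion of the disk" (0),
"bounds an immersed disk" (6: GordonKirby1984 volume, Donaldson–Thomas LMS 150, Contemp. Math. 44
(knot-theory hit, checked in-book),
Kauffman Formal Knot Theory, Freedman's 2013 Bing-topology lectures, Ghomi 1305.3231 — none on
immersed 3-spheres bounding 4-balls),
"immersion extends to an immersion" (1, history volume); `lit frontier SmoothPoincare4 --since 2021`
(30 rows, none immersion-theoretic);
`lit bridges Smoo  [refs: 10.1007/bf02566085, 10.1090/s0002-9947-96-01572-3`, 10.1090/s0002-9947-96-01572-3, 10.1112/blms/bdv044, 1309.6526, 2006.03109, doi:10.1007/bf02566085, arxiv:1309.6526, doi:10.1090/s0002-9947-96-01572-3, doi:10.1112/blms/bdv044, Francis1970, Bailey1975, Eccles1980, Eccles1981, Kinjo2015, Pappas1996, GordonKirby1984, Hughes1992, EkholmTakase2010, Freedman1978, KnudsenKupers2024, GabaiNaylorSchwartz2]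

Barriers (technique_class: codim-zero-immersions, blank-extension-theory): - technique_class: codim-zero-immersions, blank-extension-theory
- Literature.Barriers.SmoothPoincare4.OpenAnalogueBarrierFour: respected, not engaged — nothing is
concluded from int Δ_e ≅ ℝ⁴ or from an OPEN embedding; CoveringLemma and NoTripleRung need the
COMPACT Δ_e with its boundary crease, and conclude only "unit"; the barrier's small exotic ℝ⁴ ⊂ S⁴
has no compact core with S³ boundary to which the sheet count applies.
- Literature.Barriers.SmoothPoincare4.TwistedSphereBarrierFour: used positively (Δ_e ≅ D⁴ ⇒ twisted
sphere ⇒ S⁴ via cerf_twistedSphere_four in RoundCreaseStandard / SchoenfliesGlue); consistent with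
it: a round or embedded crease never presents an exotic Σ.
- Literature.Barriers.SmoothPoincare4.RelativeContractibleBarrierFour: corks show boundary-relative
smooth rigidity fails for contractible pieces with homology-sphere boundary; here ∂Δ_e = S³ and
every piece of the origami is flat (a cover of a region of ℝ⁴), so a cork is not a competitor as a
WHOLE — but a Mazur-type region of ℝ⁴ with π₁ ≠ 1 carrying a connected sheet cover is exactly where
a cork-like phenomenon could hide, which is NoTripleRung's stated failure mode; the bet is that
double-point-only creases cannot produce it.
- Literature.Barriers.SmoothPoincare4.ContractibleBarrierFour: same as above (absolute exotic
contractible pairs have ∂ ≠ S³; BoundaryDeterminesBall is stated for S³-bounded fake balls with a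
common crease germ only).
- Literature.Barriers.SmoothPoincare4.TopologicalBarrierFou

Novelty grade: new-combination — NEW-COMBINATION (thin), agreeing with card audit 24-0 after my own search 2026-08-15. Known as such: immersed fake balls exist and are unique up to regular homotopy = 7486; covering lemma (sheet counting, folklore) = 7482; Schoenflies ball iff unit (Gabai et al.); Assembly = SchoenfliesSplit with (A (refuter refuter-rreview-route-AtomisticToContinu-5fb1b065-g2-0, 2026-08-15T14:29:32Z; prior: Hirsch1959 / Poenaru1962 / Phillips1967 (equidimensional h-principle) = item 7486, doi:10.1090/s0002-9947-96-01572-3 Pappas1996 (higher-dim Blank extension calculus; unread, acq-01956 open), Francis1970 / Bailey1975 / Mcintyre1997 (Blank extension theory, dim 2), doi:10.1090/s0002-9947-1986-0857434-8 Carter1986 (removing n-tuple points of codim-1 immersions; n=3 = triple points in R^4) - uncited n)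

History (route lifecycle, newest last):
- 2026-08-15T16:20:04Z · rev 2: restated RoundCreaseStandard (stmt-SmoothPoincare4-7483), SchoenfliesGlue (stmt-SmoothPoincare4-7484), Assembly (stmt-SmoothPoincare4-7489) — route-repair (cone): remove the cite-only named fact Literature.Topology.FourManifolds.cerf_twistedSphere_four from the route's dependency cone and drop the imp (planner-rbadge-SmoothPoincare4-EuclideanOrigam-9ba4878a-g4-0)
- 2026-08-15T16:23:07Z · rev 3: restated Schoenflies (stmt-SmoothPoincare4-0372), SchoenfliesGlue (stmt-SmoothPoincare4-10645) — route-repair (cone, last entry): the gate's deps check listed Literature.Topology.FourManifolds.SmoothSchoenfliesConjectureFour (open conjecture, [status: open] (planner-rbadge-SmoothPoincare4-EuclideanOrigam-9ba4878a-g4-0)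
- 2026-08-16T02:18:12Z · AUTO-CRUX: 1 conjecture-grade item(s) promoted to crux (SchsplitCerf) — refuter vetting / tiering apply (operator:999:1362873)
- 2026-08-22T23:11:37Z · DORMANT — reconciler: no traction for 5.7 d (last activity statement-grounded at 2026-08-17T04:43:26Z); parked, not closed — `ledger route dormant route-SmoothPoincare4-E (operator:999:2678004)
- 2026-08-30T17:52:58Z · REACTIVATED (open) — reconciler: reactivated — activity statement-checked at 2026-08-30T16:34:44Z after parking at 2026-08-22T23:11:37Z (operator:999:1991418)
- 2026-09-04T19:05:37Z · DORMANT — reconciler: no traction for 5 d (last activity statement-checked at 2026-08-30T17:57:53Z); parked, not closed — `ledger route dormant route-SmoothPoincare4-Eucl (operator:999:2439262)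

sub-problem: SmoothPoincare4 · status: dormant · opened planner-plancard-SmoothPoincare4-SmoothPoinca-b1190094-0 2026-08-15T12:10:53Z · rev 5 · ledger route-SmoothPoincare4-EuclideanOrigami
GENERATED by the gate from the ledger (D-0016/17). Provers cite these decls: `theorem foo : Summit.SmoothPoincare4.SmoothPoincare4.Theses.EuclideanOrigami.<Decl> := …` in Summits/SmoothPoincare4/SmoothPoincare4/Theorems/<Name>.lean.
-/

namespace Summit.SmoothPoincare4.SmoothPoincare4.Theses.EuclideanOrigami

open scoped BigOperators Topology Manifold Classical MeasureTheory ProbabilityTheory Matrix InnerProductSpace ComplexConjugate ContinuousMap ContDiff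
open Filter Set Function TopologicalSpace MeasureTheory

attribute [summit_statement] _root_.SmoothPoincare4

open Literature.SPC4

/-- item stmt-SmoothPoincare4-7480 · crux · rank 2 · open · by planner
why it might fail: A double-point-only crease fixes the regions of ℝ⁴ ∖ F(e(S³)) and the local sheet rules, not the monodromy of sheets over regions with π₁ ≠ 1; a connected cover there may assemble a fake ball sharing its crease with B⁴ (4D Milnor doodle), or the rung may contain Schoenflies-hard cases.
sources: Pappas1996, Francis1970, Mcintyre1997, Freedman1978, Eccles1980
[crux] (card Q3, "first rung") for every homotopy 4-sphere S, smooth embedding e : ℝ⁴ → S and F : S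
→ ℝ⁴ that is a local diffeomorphism at every point outside e(B̊⁴): if the crease F ∘ e|S³ has no
triple points (F (e u) = F (e v) = F (e w) with ‖u‖ = ‖v‖ = ‖w‖ = 1 forces two of u, v, w to
coincide), then Δ_e admits an injective immersion G into ℝ⁴ (Δ_e is a Schoenflies ball, S is
invertible). [deps: CoveringLemma] [difficulty: open-problem] -/
@[route_item "route-SmoothPoincare4-EuclideanOrigami"]
def NoTripleRung : Prop :=
  ∀ (S : Literature.Topology.FourManifolds.HomotopySphere 4) (e : EuclideanSpace ℝ (Fin 4) → S.carrier) (F : S.carrier → EuclideanSpace ℝ (Fin 4)), Manifold.IsSmoothEmbedding (𝓡 4) (𝓡 4) ∞ e → (∀ x, x ∉ e '' Metric.ball (0 : EuclideanSpace ℝ (Fin 4)) 1 → IsLocalDiffeomorphAt (𝓡 4) (𝓡 4) ∞ F x) → (∀ u v w : EuclideanSpace ℝ (Fin 4), ‖u‖ = 1 → ‖v‖ = 1 → ‖w‖ = 1 → F (e u) = F (e v) → F (e v) = F (e w) → u = v ∨ v = w ∨ u = w) → ∃ G : S.carrier → EuclideanSpace ℝ (Fin 4), (∀ x, x ∉ e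 '' Metric.ball (0 : EuclideanSpace ℝ (Fin 4)) 1 → IsLocalDiffeomorphAt (𝓡 4) (𝓡 4) ∞ G x) ∧ Set.InjOn G (e '' Metric.ball (0 : EuclideanSpace ℝ (Fin 4)) 1)ᶜ

/-- item stmt-SmoothPoincare4-7481 · crux · rank 3 · open · by planner
why it might fail: Imm(Δ,ℝ⁴) is connected, but no move is known that removes triple curves of the crease while keeping the immersion extendable over Δ (the relative equidimensional h-principle fails: Blank); the minimal crease of a non-unit may need triple or quadruple points.
sources: Hirsch1959, Poenaru1962, Phillips1967, Hughes1992, Kinjo2015, Eccles1981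
[crux] (complexity-collapse half) for every homotopy 4-sphere S and smooth embedding e : ℝ⁴ → S
there is F : S → ℝ⁴, a local diffeomorphism at every point outside e(B̊⁴), whose crease F ∘ e|S³ has
no triple points. [deps: HirschPoenaruImmersion] [difficulty: open-problem] -/
@[route_item "route-SmoothPoincare4-EuclideanOrigami"]
def CreaseCollapse : Prop :=
  ∀ (S : Literature.Topology.FourManifolds.HomotopySphere 4) (e : EuclideanSpace ℝ (Fin 4) → S.carrier), Manifold.IsSmoothEmbedding (𝓡 4) (𝓡 4) ∞ e → ∃ F : S.carrier → EuclideanSpace ℝ (Fin 4), (∀ x, x ∉ e '' Metric.ball (0 : EuclideanSpace ℝ (Fin 4)) 1 → IsLocalDiffeomorphAt (𝓡 4) (𝓡 4) ∞ F x) ∧ ∀ u v w : EuclideanSpace ℝ (Fin 4), ‖u‖ = 1 → ‖v‖ = 1 → ‖w‖ = 1 → F (e u) = F (e v) → F (e v) = F (e w) → u = v ∨ v = w ∨ u = w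

-- earlier Schoenflies (stmt-SmoothPoincare4-0372, replaced 2026-08-15T16:23:07Z -> stmt-SmoothPoincare4-10753): open — Literature.Topology.FourManifolds.SmoothSchoenfliesConjectureFour
/-- item stmt-SmoothPoincare4-10753 · crux · rank 4 · open · by planner
why it might fail: Open since Mazur1959; known only for genus ≤ 2 embeddings (Scharlemann1984) and special families (Gompf1991Killing); knotted 3-balls (BudneyGabai2019) kill the relative form, so (B) may fail even if SPC4 holds.
sources: Mazur1959, Kirby1989, Scharlemann1984, Gompf1991Killing, BudneyGabai2019
[crux] the smooth 4-dimensional Schoenflies conjecture, equator form, stated VERBATIM in the route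
(definitionally equal to the Literature def
`Literature.Topology.FourManifolds.SmoothSchoenfliesConjectureFour`, SPC4Wave0.lean, [status: open];
restated 2026-08-15 from the alias form stmt-SmoothPoincare4-0372, which stays with route
SchoenfliesSplit as item (B)): every smooth embedding f : S³ → S⁴ (Mathlib
`Manifold.IsSmoothEmbedding (𝓡 3) (𝓡 4) ∞ f`, round unit spheres with their stereographic smooth
structures) is carried onto the equator `sphereFourEquator = {x | x₄ = 0}` by a diffeomorphism of
S⁴. Known: true after # (S²×S²) (Mazur1959); true for Schoenflies balls with 3-handle-free
decompositions (Scharlemann1984; Gompf1991Killing); ball form ↔ equator form proved in tree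
(`smoothSchoenfliesConjectureFour_iff_ballForm`, Palais). [difficulty: open-problem] Sources:
Mazur1959; Kirby1989 (Kirby1997 4.32); Scharlemann1984; Gompf1991Killing; BudneyGabai2019. -/
@[route_item "route-SmoothPoincare4-EuclideanOrigami"]
def Schoenflies : Prop :=
  ∀ f : Metric.sphere (0 : EuclideanSpace ℝ (Fin 4)) 1 → Metric.sphere (0 : EuclideanSpace ℝ (Fin 5)) 1, Manifold.IsSmoothEmbedding (𝓡 3) (𝓡 4) ∞ f → ∃ φ : Metric.sphere (0 : EuclideanSpace ℝ (Fin 5)) 1 ≃ₘ⟮𝓡 4, 𝓡 4⟯ Metric.sphere (0 : EuclideanSpace ℝ (Fin 5)) 1, φ '' Set.range f = Literature.Topology.FourManifolds.sphereFourEquator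

/-- item stmt-SmoothPoincare4-17727 · crux · rank 5 · open · by planner
why it might fail: No obstruction survives (crease null-bordant) but no elimination move the filling can follow is known: Carter1986 kills triple curves only by surgery on the source, fixed here (S³ = ∂Δ_e); for an exotic Δ_e a minimal quadruple-free crease may need triple circles (the rung IS the crux given rung 3).
sources: Carter1986, Eccles1980, Herbert1981, Hughes1992, Kinjo2015, Pappas1996
[crux] RUNG 3 → 2 of the crease ladder (crux-strategist split of CreaseCollapse, 2026-08-17): for
every homotopy 4-sphere S, chart e and immersed fake ball F whose crease is QUADRUPLE-FREE with
finitely many connected components of its triple-value set, at least one non-empty, there is an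
immersed fake ball F' for the same (S, e) with quadruple-free crease and STRICTLY FEWER triple-value
components. Per (S, e) this is exactly the rung implication (a tame quadruple-free immersed fake
ball exists) → (a TRIPLE-POINT-FREE one exists, i.e. CreaseCollapse at (S, e)) (kernel-checked:
SeamByName.lean, tripleCircleElimination_iff); birth line
Cruxes/CreaseCollapse/Lines/ladder_triple.lean (stub_isolateComponent, provable now;
stub_conservativeElimination — eliminate one isolated triple circle creating no new triple value,
the open move; cf. Carter1986, who removes n-tuple points of codimension-one immersions by surgery
on the SOURCE, not available here since the source S³ = ∂Δ_e and the filling Δ_e are fixed). Implied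
by CreaseCollapse (SeamByName.tripleCircleElimination_of_creaseCollapse); true for S ≅ S⁴;
irrefutable short of an exotic 4-sphere with an obstruction. [difficulty: open-probl -/
@[route_item "route-SmoothPoincare4-EuclideanOrigami"]
def TripleCircleElimination : Prop :=
  ∀ (S : Literature.Topology.FourManifolds.HomotopySphere 4) (e : EuclideanSpace ℝ (Fin 4) → S.carrier) (F : S.carrier → EuclideanSpace ℝ (Fin 4)), Manifold.IsSmoothEmbedding (𝓡 4) (𝓡 4) ∞ e → (∀ x, x ∉ e '' Metric.ball (0 : EuclideanSpace ℝ (Fin 4)) 1 → IsLocalDiffeomorphAt (𝓡 4) (𝓡 4) ∞ F x) → {y : EuclideanSpace ℝ (Fin 4) | ∃ a b c d : EuclideanSpace ℝ (Fin 4), ‖a‖ = 1 ∧ ‖b‖ = 1 ∧ ‖c‖ = 1 ∧ ‖d‖ = 1 ∧ a ≠ b ∧ a ≠ c ∧ a ≠ d ∧ b ≠ c ∧ b ≠ d ∧ c ≠ d ∧ F (e a) = y ∧ F (e b) = y ∧ F (e c) = y ∧ F (e d) = y} = ∅ → ((fun y => connectedComponentIn {y : EuclideanSpace ℝ (Fin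 4) | ∃ u v w : EuclideanSpace ℝ (Fin 4), ‖u‖ = 1 ∧ ‖v‖ = 1 ∧ ‖w‖ = 1 ∧ u ≠ v ∧ v ≠ w ∧ u ≠ w ∧ F (e u) = y ∧ F (e v) = y ∧ F (e w) = y} y) '' {y : EuclideanSpace ℝ (Fin 4) | ∃ u v w : EuclideanSpace ℝ (Fin 4), ‖u‖ = 1 ∧ ‖v‖ = 1 ∧ ‖w‖ = 1 ∧ u ≠ v ∧ v ≠ w ∧ u ≠ w ∧ F (e u) = y ∧ F (e v) = y ∧ F (e w) = y}).Finite → {y : EuclideanSpace ℝ (Fin 4) | ∃ u v w : EuclideanSpace ℝ (Fin 4), ‖u‖ = 1 ∧ ‖v‖ = 1 ∧ ‖w‖ = 1 ∧ u ≠ v ∧ v ≠ w ∧ u ≠ w ∧ F (e u) = y ∧ F (e v) = y ∧ F (e w) = y}.Nonempty → ∃ F' : S.carrier → EuclideanSpace ℝ (Fin 4), (∀ x, x ∉ e '' Metric.ball (0 : EuclideanSpace ℝ (Fin 4)) 1 → IsLocalDiffeomorphAt (𝓡 4) (𝓡 4) ∞ F' x) ∧ {y : EuclideanSpace ℝ (Fin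 4) | ∃ a b c d : EuclideanSpace ℝ (Fin 4), ‖a‖ = 1 ∧ ‖b‖ = 1 ∧ ‖c‖ = 1 ∧ ‖d‖ = 1 ∧ a ≠ b ∧ a ≠ c ∧ a ≠ d ∧ b ≠ c ∧ b ≠ d ∧ c ≠ d ∧ F' (e a) = y ∧ F' (e b) = y ∧ F' (e c) = y ∧ F' (e d) = y} = ∅ ∧ ((fun y => connectedComponentIn {y : EuclideanSpace ℝ (Fin 4) | ∃ u v w : EuclideanSpace ℝ (Fin 4), ‖u‖ = 1 ∧ ‖v‖ = 1 ∧ ‖w‖ = 1 ∧ u ≠ v ∧ v ≠ w ∧ u ≠ w ∧ F' (e u) = y ∧ F' (e v) = y ∧ F' (e w) = y} y) '' {y : EuclideanSpace ℝ (Fin 4) | ∃ u v w : EuclideanSpace ℝ (Fin 4), ‖u‖ = 1 ∧ ‖v‖ = 1 ∧ ‖w‖ = 1 ∧ u ≠ v ∧ v ≠ w ∧ u ≠ w ∧ F' (e u) = y ∧ F' (e v) = y ∧ F' (e w) = y}).Finite ∧ ((fun y => connectedComponentIn {y : EuclideanSpace ℝ (Fin 4) | ∃ u v w : EuclideanSpace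 ℝ (Fin 4), ‖u‖ = 1 ∧ ‖v‖ = 1 ∧ ‖w‖ = 1 ∧ u ≠ v ∧ v ≠ w ∧ u ≠ w ∧ F' (e u) = y ∧ F' (e v) = y ∧ F' (e w) = y} y) '' {y : EuclideanSpace ℝ (Fin 4) | ∃ u v w : EuclideanSpace ℝ (Fin 4), ‖u‖ = 1 ∧ ‖v‖ = 1 ∧ ‖w‖ = 1 ∧ u ≠ v ∧ v ≠ w ∧ u ≠ w ∧ F' (e u) = y ∧ F' (e v) = y ∧ F' (e w) = y}).ncard < ((fun y => connectedComponentIn {y : EuclideanSpace ℝ (Fin 4) | ∃ u v w : EuclideanSpace ℝ (Fin 4), ‖u‖ = 1 ∧ ‖v‖ = 1 ∧ ‖w‖ = 1 ∧ u ≠ v ∧ v ≠ w ∧ u ≠ w ∧ F (e u) = y ∧ F (e v) = y ∧ F (e w) = y} y) '' {y : EuclideanSpace ℝ (Fin 4) | ∃ u v w : EuclideanSpace ℝ (Fin 4), ‖u‖ = 1 ∧ ‖v‖ = 1 ∧ ‖w‖ = 1 ∧ u ≠ v ∧ v ≠ w ∧ u ≠ w ∧ F (e u) = y ∧ F (e v)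 = y ∧ F (e w) = y}).ncard

/-- item stmt-SmoothPoincare4-17726 · crux · rank 6 · open · by planner
why it might fail: Only the PARITY of the quadruple-point number is invariant (Kirby list N4.61E, Freedman1978); no move is known cancelling a ± pair of quadruple points while the immersion stays extendable over Δ_e (Whitney 2-discs meet the 3-dim crease generically); an exotic Δ_e may force quadruple points.
sources: Freedman1978, Eccles1980, Eccles1981, Herbert1981, Kinjo2015, Hughes1992
[crux] RUNG 4 → 3 of the crease ladder (crux-strategist split of CreaseCollapse, 2026-08-17): for
every homotopy 4-sphere S, chart e and immersed fake ball F whose crease is tame (finitely many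
quadruple values, finitely many triple-value components) and HAS a quadruple value, there is an
immersed fake ball F' for the same (S, e) with tame crease and STRICTLY FEWER quadruple values. Per
(S, e) this is exactly the rung implication (a tame immersed fake ball exists) → (a tame
QUADRUPLE-FREE one exists) (kernel-checked: Cruxes/CreaseCollapse/SeamByName.lean,
quadrupleCancellation_iff); the one-defect form is the one the birth line attacks
(Cruxes/CreaseCollapse/Lines/ladder_quad.lean: stub_quadParity — a generic crease has an EVEN number
of quadruple points, the count mod 2 being a regular-homotopy invariant of immersed 3-spheres in ℝ⁴
(Kirby list 1984 N4.61(E), Contemp. Math. 35 p. 472; Freedman1978; Eccles1980) and the crease being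
regularly homotopic to the round sphere (Hughes1992, Kinjo2015 Thm 2.2) / null-bordant;
stub_quadPairCancel — cancel a PAIR through immersed fake balls, the open move). Implied by
CreaseCollapse (SeamByName.quadrupleCancellation_of_creaseCollapse); true f -/
@[route_item "route-SmoothPoincare4-EuclideanOrigami"]
def QuadrupleCancellation : Prop :=
  ∀ (S : Literature.Topology.FourManifolds.HomotopySphere 4) (e : EuclideanSpace ℝ (Fin 4) → S.carrier) (F : S.carrier → EuclideanSpace ℝ (Fin 4)), Manifold.IsSmoothEmbedding (𝓡 4) (𝓡 4) ∞ e → (∀ x, x ∉ e '' Metric.ball (0 : EuclideanSpace ℝ (Fin 4)) 1 → IsLocalDiffeomorphAt (𝓡 4) (𝓡 4) ∞ F x) → {y : EuclideanSpace ℝ (Fin 4) | ∃ a b c d : EuclideanSpace ℝ (Fin 4), ‖a‖ = 1 ∧ ‖b‖ = 1 ∧ ‖c‖ = 1 ∧ ‖d‖ = 1 ∧ a ≠ b ∧ a ≠ c ∧ a ≠ d ∧ b ≠ c ∧ b ≠ d ∧ c ≠ d ∧ F (e a) = y ∧ F (e b) = y ∧ F (e c) = y ∧ F (e d) = y}.Finite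 → {y : EuclideanSpace ℝ (Fin 4) | ∃ a b c d : EuclideanSpace ℝ (Fin 4), ‖a‖ = 1 ∧ ‖b‖ = 1 ∧ ‖c‖ = 1 ∧ ‖d‖ = 1 ∧ a ≠ b ∧ a ≠ c ∧ a ≠ d ∧ b ≠ c ∧ b ≠ d ∧ c ≠ d ∧ F (e a) = y ∧ F (e b) = y ∧ F (e c) = y ∧ F (e d) = y}.Nonempty → ((fun y => connectedComponentIn {y : EuclideanSpace ℝ (Fin 4) | ∃ u v w : EuclideanSpace ℝ (Fin 4), ‖u‖ = 1 ∧ ‖v‖ = 1 ∧ ‖w‖ = 1 ∧ u ≠ v ∧ v ≠ w ∧ u ≠ w ∧ F (e u) = y ∧ F (e v) = y ∧ F (e w) = y} y) '' {y : EuclideanSpace ℝ (Fin 4) | ∃ u v w : EuclideanSpace ℝ (Fin 4), ‖u‖ = 1 ∧ ‖v‖ = 1 ∧ ‖w‖ = 1 ∧ u ≠ v ∧ v ≠ w ∧ u ≠ w ∧ F (e u) = y ∧ F (e v) = y ∧ F (e w) = y}).Finite → ∃ F' : S.carrier → EuclideanSpace ℝ (Fin 4), (∀ x, x ∉ e ''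 Metric.ball (0 : EuclideanSpace ℝ (Fin 4)) 1 → IsLocalDiffeomorphAt (𝓡 4) (𝓡 4) ∞ F' x) ∧ {y : EuclideanSpace ℝ (Fin 4) | ∃ a b c d : EuclideanSpace ℝ (Fin 4), ‖a‖ = 1 ∧ ‖b‖ = 1 ∧ ‖c‖ = 1 ∧ ‖d‖ = 1 ∧ a ≠ b ∧ a ≠ c ∧ a ≠ d ∧ b ≠ c ∧ b ≠ d ∧ c ≠ d ∧ F' (e a) = y ∧ F' (e b) = y ∧ F' (e c) = y ∧ F' (e d) = y}.Finite ∧ {y : EuclideanSpace ℝ (Fin 4) | ∃ a b c d : EuclideanSpace ℝ (Fin 4), ‖a‖ = 1 ∧ ‖b‖ = 1 ∧ ‖c‖ = 1 ∧ ‖d‖ = 1 ∧ a ≠ b ∧ a ≠ c ∧ a ≠ d ∧ b ≠ c ∧ b ≠ d ∧ c ≠ d ∧ F' (e a) = y ∧ F' (e b) = y ∧ F' (e c) = y ∧ F' (e d) = y}.ncard < {y : EuclideanSpace ℝ (Fin 4) | ∃ a b c d : EuclideanSpace ℝ (Fin 4), ‖a‖ = 1 ∧ ‖b‖ = 1 ∧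 ‖c‖ = 1 ∧ ‖d‖ = 1 ∧ a ≠ b ∧ a ≠ c ∧ a ≠ d ∧ b ≠ c ∧ b ≠ d ∧ c ≠ d ∧ F (e a) = y ∧ F (e b) = y ∧ F (e c) = y ∧ F (e d) = y}.ncard ∧ ((fun y => connectedComponentIn {y : EuclideanSpace ℝ (Fin 4) | ∃ u v w : EuclideanSpace ℝ (Fin 4), ‖u‖ = 1 ∧ ‖v‖ = 1 ∧ ‖w‖ = 1 ∧ u ≠ v ∧ v ≠ w ∧ u ≠ w ∧ F' (e u) = y ∧ F' (e v) = y ∧ F' (e w) = y} y) '' {y : EuclideanSpace ℝ (Fin 4) | ∃ u v w : EuclideanSpace ℝ (Fin 4), ‖u‖ = 1 ∧ ‖v‖ = 1 ∧ ‖w‖ = 1 ∧ u ≠ v ∧ v ≠ w ∧ u ≠ w ∧ F' (e u) = y ∧ F' (e v) = y ∧ F' (e w) = y}).Finite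

/-- item stmt-SmoothPoincare4-8758 · crux (kind.auto-crux: conjecture-grade) · rank 9 · open · by planner
why it might fail: auto-crux — conjecture-grade statement (docstring avows it ('conjecture')); it is open, so it may simply be false
sources: conjecture-registry
[support] Cerf's theorem Γ₄ = 0 in twisted-sphere form — every twisted 4-sphere D⁴ ∪_φ D⁴ is
diffeomorphic to S⁴ — VERBATIM the body of the tree's named fact
`Literature.Topology.FourManifolds.cerf_twistedSphere_four` (CerfGammaFour.lean; Cerf 1968 main
theorem, Kervaire–Milnor 1963 §1, Milnor 1965 §9; reproved through Hatcher's Smale conjecture and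
Eliashberg's filling by discs). Filed as an item so the route's single genuinely needed unproved
fact is visible tier-0 debt (needs-fact: Literature.Topology.FourManifolds.cerf_twistedSphere_four)
without importing CerfGammaFour into the route file; the tree already reduces the fact to the leaf
π₀ Diff(D³ rel ∂) = 0 (`cerf_twistedSphere_four_of_relBoundary`,
`cerf_twistedSphere_four_of_pi0Diff'`, `cerf_twistedSphere_four_of_extends'`); this item closes by
`cerf_twistedSphere_four` itself the day the Literature discharges it. Known theorem: formalisation
debt, not research. [difficulty: XL] Sources: CerfDiffeoSphere1968, KervaireMilnorAnnals1963,
MilnorHCobordism1965. -/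
@[route_item "route-SmoothPoincare4-EuclideanOrigami"]
def SchsplitCerf : Prop :=
  ∀ [Fact (Literature.Topology.FourManifolds.isSmoothEmbedding_sphereInclusion' 3)] (φ : (Metric.sphere (0 : EuclideanSpace ℝ (Fin 4)) 1) ≃ₘ⟮𝓡 3, 𝓡 3⟯ (Metric.sphere (0 : EuclideanSpace ℝ (Fin 4)) 1)) (T : Literature.Topology.FourManifolds.TwistedSphere 3 φ), Nonempty (T.carrier ≃ₘ⟮𝓡 4, 𝓡 4⟯ Metric.sphere (0 : EuclideanSpace ℝ (Fin 5)) 1)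

-- earlier RoundCreaseStandard (stmt-SmoothPoincare4-7483, replaced 2026-08-15T16:20:04Z -> stmt-SmoothPoincare4-10644): retired by None — Literature.Topology.FourManifolds.cerf_twistedSphere_four → ∀ (S : Literature.Topology.FourManifolds.HomotopySphere 4) (e : EuclideanSpace ℝ (Fin 4) → S.carrier) (F : S.carrier → EuclideanSpace ℝ (Fin 4)), Manifold.IsSmoothEmbedding (𝓡 4) (𝓡 4) ∞ e → (∀ x, x ∉ e '
/-- item stmt-SmoothPoincare4-10644 · support · rank 9 · open · by planner
sources: Cerf1968, Palais1960, KervaireMilnor1963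
[support] (card: "B⁴ iff the boundary can be round") under Cerf Γ₄ = 0 in twisted-sphere form —
spelled VERBATIM as the antecedent (the body of the named fact
`Literature.Topology.FourManifolds.cerf_twistedSphere_four`, identical to the route item
SchsplitCerf; restated 2026-08-15 only to take the Literature constant out of the cone, meaning
unchanged): if some immersed fake ball has its crease inside a round sphere (dist (F (e u)) c = r
for ‖u‖ = 1; then r > 0 and F ∘ e|S³ is a covering of the round S³, hence injective), then by
CoveringLemma F(Δ_e) is the closed round ball, Δ_e ≅ D⁴ compatibly with e, S is a twisted sphere and
S ≅ S⁴. [difficulty: XL] Sources: Cerf1968, Palais1960, KervaireMilnor1963. -/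
@[route_item "route-SmoothPoincare4-EuclideanOrigami"]
def RoundCreaseStandard : Prop :=
  (∀ [Fact (Literature.Topology.FourManifolds.isSmoothEmbedding_sphereInclusion' 3)] (φ : (Metric.sphere (0 : EuclideanSpace ℝ (Fin 4)) 1) ≃ₘ⟮𝓡 3, 𝓡 3⟯ (Metric.sphere (0 : EuclideanSpace ℝ (Fin 4)) 1)) (T : Literature.Topology.FourManifolds.TwistedSphere 3 φ), Nonempty (T.carrier ≃ₘ⟮𝓡 4, 𝓡 4⟯ Metric.sphere (0 : EuclideanSpace ℝ (Fin 5)) 1)) → ∀ (S : Literature.Topology.FourManifolds.HomotopySphere 4) (e : EuclideanSpace ℝ (Fin 4) → S.carrier) (F : S.carrier → EuclideanSpace ℝ (Fin 4)), Manifold.IsSmoothEmbedding (𝓡 4) (𝓡 4) ∞ e → (∀ x, x ∉ e '' Metric.ball (0 : EuclideanSpace ℝ (Fin 4)) 1 → IsLocalDiffeomorphAt (𝓡 4) (𝓡 4) ∞ F x) → (∃ (c : EuclideanSpace ℝ (Fin 4)) (r : ℝ), ∀ u : EuclideanSpace ℝ (Fin 4), ‖u‖ = 1 → dist (F (e u))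 c = r) → Nonempty (S.carrier ≃ₘ⟮𝓡 4, 𝓡 4⟯ Metric.sphere (0 : EuclideanSpace ℝ (Fin 5)) 1)

-- earlier SchoenfliesGlue (stmt-SmoothPoincare4-10645, replaced 2026-08-15T16:23:07Z -> stmt-SmoothPoincare4-10754): retired by None — (∀ [Fact (Literature.Topology.FourManifolds.isSmoothEmbedding_sphereInclusion' 3)] (φ : (Metric.sphere (0 : EuclideanSpace ℝ (Fin 4)) 1) ≃ₘ⟮𝓡 3, 𝓡 3⟯ (Metric.sphere (0 : EuclideanSpace ℝ (Fin 4)) 1)) (T : Literature.Topology.FourManifolds.TwistedSphere 3 φ), Nonempty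
-- earlier SchoenfliesGlue (stmt-SmoothPoincare4-7484, replaced 2026-08-15T16:20:04Z -> stmt-SmoothPoincare4-10645): retired by None — Literature.Topology.FourManifolds.cerf_twistedSphere_four → (∀ (S : Literature.Topology.FourManifolds.HomotopySphere 4) (e : EuclideanSpace ℝ (Fin 4) → S.carrier), Manifold.IsSmoothEmbedding (𝓡 4) (𝓡 4) ∞ e → ∃ G : S.carrier → EuclideanSpace ℝ (Fin 4), (∀ x, x ∉ e '' 
/-- item stmt-SmoothPoincare4-10754 · support · rank 9 · open · by planner
sources: Cerf1968, Palais1960, Kirby1989, Mazur1959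
[support] (glue to the summit form, classical) with BOTH external inputs spelled verbatim as
antecedents (meaning unchanged; restated 2026-08-15 only to keep Literature constants without
witnesses out of the cone): (Cerf Γ₄ = 0 in twisted-sphere form — the body of
`Literature.Topology.FourManifolds.cerf_twistedSphere_four`, identical to item SchsplitCerf) →
(every fake ball Δ_e admits an injective immersion G into ℝ⁴) → (smooth Schoenflies, equator form —
identical to item Schoenflies, definitionally `SmoothSchoenfliesConjectureFour`) → every homotopy
4-sphere is diffeomorphic to S⁴. Proof: σ⁻¹ ∘ G ∘ e|S³ is a smooth S³ ⊂ S⁴; G(int Δ_e) is exactly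
the bounded complementary region (clopen argument); Schoenflies in ball form on the far side of the
north pole (tree: `SmoothSchoenfliesConjectureFour.exists_ball_not_mem`, applies to the verbatim
hypothesis by defeq) makes G(Δ_e) a smooth closed 4-ball, so Δ_e ≅ D⁴ and S = e(D⁴) ∪ Δ_e is a
twisted sphere (`Literature.Topology.FourManifolds.IsTwistedSphere`); Cerf gives S ≅ S⁴.
[difficulty: XL] Sources: Cerf1968, Palais1960, Kirby1989, Mazur1959. -/
@[route_item "route-SmoothPoincare4-EuclideanOrigami"]
def SchoenfliesGlue : Prop :=
  (∀ [Fact (Literature.Topology.FourManifolds.isSmoothEmbedding_sphereInclusion' 3)] (φ : (Metric.sphere (0 : EuclideanSpace ℝ (Fin 4)) 1) ≃ₘ⟮𝓡 3, 𝓡 3⟯ (Metric.sphere (0 : EuclideanSpace ℝ (Fin 4)) 1)) (T : Literature.Topology.FourManifolds.TwistedSphere 3 φ), Nonempty (T.carrier ≃ₘ⟮𝓡 4, 𝓡 4⟯ Metric.sphere (0 : EuclideanSpace ℝ (Fin 5)) 1)) → (∀ (S : Literature.Topology.FourManifolds.HomotopySphere 4) (e : EuclideanSpace ℝ (Fin 4)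 → S.carrier), Manifold.IsSmoothEmbedding (𝓡 4) (𝓡 4) ∞ e → ∃ G : S.carrier → EuclideanSpace ℝ (Fin 4), (∀ x, x ∉ e '' Metric.ball (0 : EuclideanSpace ℝ (Fin 4)) 1 → IsLocalDiffeomorphAt (𝓡 4) (𝓡 4) ∞ G x) ∧ Set.InjOn G (e '' Metric.ball (0 : EuclideanSpace ℝ (Fin 4)) 1)ᶜ) → (∀ f : Metric.sphere (0 : EuclideanSpace ℝ (Fin 4)) 1 → Metric.sphere (0 : EuclideanSpace ℝ (Fin 5)) 1, Manifold.IsSmoothEmbedding (𝓡 3) (𝓡 4) ∞ f → ∃ φ : Metric.sphere (0 : EuclideanSpace ℝ (Fin 5)) 1 ≃ₘ⟮𝓡 4, 𝓡 4⟯ Metric.sphere (0 : EuclideanSpace ℝ (Fin 5)) 1, φ '' Set.range f = Literature.Topology.FourManifolds.sphereFourEquator) → ∀ S : Literature.Topology.FourManifolds.HomotopySphere 4, Nonempty (S.carrier ≃ₘ⟮𝓡 4, 𝓡 4⟯ Metric.sphere (0 : EuclideanSpace ℝ (Fin 5)) 1)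

/-- item stmt-SmoothPoincare4-17725 · support · rank 9 · open · by planner
sources: Hirsch1959, Poenaru1962, Phillips1967, GolubitskyGuillemin1973, Herbert1981
[support] RUNG 4 of the crease ladder (crux-strategist split of CreaseCollapse, 2026-08-17): for
every homotopy 4-sphere S and smooth chart e : ℝ⁴ → S, SOME immersed fake ball F (a local
diffeomorphism at every point off e(B̊⁴)) has a TAME crease F ∘ e|S³ — finitely many quadruple
values and finitely many connected components of its triple-value set. KNOWN IN PRINT, formal debt
XL: existence of F by the equidimensional h-principle (Hirsch1959/Poenaru1962/Phillips1967 Thm A; =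
route item HirschPoenaruImmersion stmt-SmoothPoincare4-7486, vendored fact
Phillips1967_exists_isLocalDiffeomorph_of_isParallelizable), tameness by multijet transversality
(GolubitskyGuillemin1973 II §4): a generic C¹-small perturbation of F near e(S³) keeps it a local
diffeomorphism on the compact Δ_e and makes the crease self-transverse, whence quadruple values are
isolated (finite) and the triple-value set is a finite union of immersed closed curves.
Load-bearing: it seeds the descent of the glue (Cruxes/CreaseCollapse/Split.lean). Implied by
CreaseCollapse (SeamByName.tameCrease_of_creaseCollapse). -/
@[route_item "route-SmoothPoincare4-EuclideanOrigami"]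
def TameCrease : Prop :=
  ∀ (S : Literature.Topology.FourManifolds.HomotopySphere 4) (e : EuclideanSpace ℝ (Fin 4) → S.carrier), Manifold.IsSmoothEmbedding (𝓡 4) (𝓡 4) ∞ e → ∃ F : S.carrier → EuclideanSpace ℝ (Fin 4), (∀ x, x ∉ e '' Metric.ball (0 : EuclideanSpace ℝ (Fin 4)) 1 → IsLocalDiffeomorphAt (𝓡 4) (𝓡 4) ∞ F x) ∧ {y : EuclideanSpace ℝ (Fin 4) | ∃ a b c d : EuclideanSpace ℝ (Fin 4), ‖a‖ = 1 ∧ ‖b‖ = 1 ∧ ‖c‖ = 1 ∧ ‖d‖ = 1 ∧ a ≠ b ∧ a ≠ c ∧ a ≠ d ∧ b ≠ c ∧ b ≠ d ∧ c ≠ d ∧ F (e a) = y ∧ F (e b) = y ∧ F (e c) = y ∧ F (e d) = y}.Finite ∧ ((fun y => connectedComponentIn {y : EuclideanSpace ℝ (Fin 4) | ∃ u v w : EuclideanSpace ℝ (Fin 4), ‖u‖ = 1 ∧ ‖v‖ = 1 ∧ ‖w‖ = 1 ∧ u ≠ v ∧ v ≠ w ∧ u ≠ w ∧ F (e u) = y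 ∧ F (e v) = y ∧ F (e w) = y} y) '' {y : EuclideanSpace ℝ (Fin 4) | ∃ u v w : EuclideanSpace ℝ (Fin 4), ‖u‖ = 1 ∧ ‖v‖ = 1 ∧ ‖w‖ = 1 ∧ u ≠ v ∧ v ≠ w ∧ u ≠ w ∧ F (e u) = y ∧ F (e v) = y ∧ F (e w) = y}).Finite

/-- item stmt-SmoothPoincare4-7482 · support · rank 9 · open · by planner
sources: Brown1960, Rushing1973, GabaiNaylorSchwartz2025
[support] (card lemma (3), sheet counting) if F is a local diffeomorphism at every point outside
e(B̊⁴) and the crease F ∘ e is injective on the unit sphere, then F is injective on Δ_e = (e(B̊⁴))ᶜ.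
Proof: the sheet number of F|int Δ_e is locally constant off the embedded 3-sphere F(e(S³)) and
vanishes near infinity, so F(int Δ_e) is the bounded complementary region, over which F is a finite
connected cover of a simply connected open set (topological Schoenflies, proved in tree:
`Literature.Topology.FourManifolds.exists_homeomorph_image_eq_sphereEquator_holds` with
`isLocallyFlat_of_isSmoothEmbedding`), hence injective. [difficulty: L] -/
@[route_item "route-SmoothPoincare4-EuclideanOrigami"]
def CoveringLemma : Prop :=
  ∀ (S : Literature.Topology.FourManifolds.HomotopySphere 4) (e : EuclideanSpace ℝ (Fin 4) → S.carrier) (F : S.carrier → EuclideanSpace ℝ (Fin 4)), Manifold.IsSmoothEmbedding (𝓡 4) (𝓡 4) ∞ e → (∀ x, x ∉ e '' Metric.ball (0 : EuclideanSpace ℝ (Fin 4)) 1 → IsLocalDiffeomorphAt (𝓡 4) (𝓡 4) ∞ F x) → Set.InjOn (F ∘ e) (Metric.sphere (0 : EuclideanSpace ℝ (Fin 4)) 1) → Set.InjOn F (e '' Metric.ball (0 : EuclideanSpace ℝ (Fin 4)) 1)ᶜ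

/-- item stmt-SmoothPoincare4-7485 · support · rank 9 · open · by planner
sources: Palais1960, Hirsch1976
[support] (link to SchoenfliesSplit (A), verbatim its conclusion) if every fake ball Δ_e admits an
injective immersion into ℝ⁴ then every punctured homotopy 4-sphere S ∖ {p} smoothly embeds in ℝ⁴:
choose e with e 0 = p; an immersion injective on the compact Δ_e is injective on S ∖ e(closed ball
of radius 1 − ε) for some ε > 0; precompose with a radial diffeomorphism S ∖ {p} ≅ S ∖ e(B̄(0, 1 −
ε)) supported in the chart; an injective local diffeomorphism is a smooth embedding. [difficulty: L] -/
@[route_item "route-SmoothPoincare4-EuclideanOrigami"]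
def PuncturedEmbeds : Prop :=
  (∀ (S : Literature.Topology.FourManifolds.HomotopySphere 4) (e : EuclideanSpace ℝ (Fin 4) → S.carrier), Manifold.IsSmoothEmbedding (𝓡 4) (𝓡 4) ∞ e → ∃ G : S.carrier → EuclideanSpace ℝ (Fin 4), (∀ x, x ∉ e '' Metric.ball (0 : EuclideanSpace ℝ (Fin 4)) 1 → IsLocalDiffeomorphAt (𝓡 4) (𝓡 4) ∞ G x) ∧ Set.InjOn G (e '' Metric.ball (0 : EuclideanSpace ℝ (Fin 4)) 1)ᶜ) → ∀ (S : Literature.Topology.FourManifolds.HomotopySphere 4) (p : S.carrier), ∃ f : (⟨{p}ᶜ, isOpen_compl_singleton⟩ : TopologicalSpace.Opens S.carrier) → EuclideanSpace ℝ (Fin 4), Manifold.IsSmoothEmbedding (𝓡 4) (𝓡 4) ∞ f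

/-- item stmt-SmoothPoincare4-7486 · support · rank 9 · open · by planner
sources: Hirsch1959, Poenaru1962, Phillips1967
[support] (card fact (1): the arena is non-empty for EVERY Σ) every fake ball immerses in ℝ⁴: for
every homotopy 4-sphere S and smooth embedding e : ℝ⁴ → S there is F : S → ℝ⁴ that is a local
diffeomorphism at every point outside e(B̊⁴). In print: an open parallelisable n-manifold immerses
(= submerses) in ℝⁿ (Hirsch1959 for immersions in codim ≥ 1 plus Poenaru1962 handle-by-handle in
codim 0; Phillips1967 Thm A for submersions of open manifolds), applied to the open set S ∖ e(B̄(0,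
1/2)) ⊂ S ∖ {e 0}, which is contractible hence parallelisable. Provable once that h-principle is
vendored as a named fact (cite item filed); implied by CreaseCollapse. [difficulty: XL] -/
@[route_item "route-SmoothPoincare4-EuclideanOrigami"]
def HirschPoenaruImmersion : Prop :=
  ∀ (S : Literature.Topology.FourManifolds.HomotopySphere 4) (e : EuclideanSpace ℝ (Fin 4) → S.carrier), Manifold.IsSmoothEmbedding (𝓡 4) (𝓡 4) ∞ e → ∃ F : S.carrier → EuclideanSpace ℝ (Fin 4), ∀ x, x ∉ e '' Metric.ball (0 : EuclideanSpace ℝ (Fin 4)) 1 → IsLocalDiffeomorphAt (𝓡 4) (𝓡 4) ∞ F x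

/-- item stmt-SmoothPoincare4-7487 · support · rank 9 · open · by planner
sources: Francis1970, Pappas1996, Bailey1975
[support] (card Q1, the "4D Milnor doodle", filed as an unstaffed side statement; with "every crease
also bounds an immersed B⁴" it would be a Schoenflies-free assembly, see Not decomposed yet) two
immersed fake balls with the same crease GERM — F (e u) = F' (e' u) for 1 ≤ ‖u‖ ≤ 1 + δ — belong to
diffeomorphic homotopy spheres. [difficulty: open-problem] -/
@[route_item "route-SmoothPoincare4-EuclideanOrigami"]
def BoundaryDeterminesBall : Prop :=
  ∀ (S S' : Literature.Topology.FourManifolds.HomotopySphere 4) (e : EuclideanSpace ℝ (Fin 4) → S.carrier) (e' : EuclideanSpace ℝ (Fin 4) → S'.carrier) (F : S.carrier → EuclideanSpace ℝ (Fin 4)) (F' : S'.carrier → EuclideanSpace ℝ (Fin 4)), Manifold.IsSmoothEmbedding (𝓡 4) (𝓡 4) ∞ e → Manifold.IsSmoothEmbedding (𝓡 4) (𝓡 4) ∞ e' → (∀ x, x ∉ e '' Metric.ball (0 : EuclideanSpace ℝ (Fin 4)) 1 → IsLocalDiffeomorphAt (𝓡 4) (𝓡 4) ∞ F x) → (∀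 x, x ∉ e' '' Metric.ball (0 : EuclideanSpace ℝ (Fin 4)) 1 → IsLocalDiffeomorphAt (𝓡 4) (𝓡 4) ∞ F' x) → (∃ δ : ℝ, 0 < δ ∧ ∀ u : EuclideanSpace ℝ (Fin 4), 1 ≤ ‖u‖ → ‖u‖ ≤ 1 + δ → F (e u) = F' (e' u)) → Nonempty (S.carrier ≃ₘ⟮𝓡 4, 𝓡 4⟯ S'.carrier)

/-- item stmt-SmoothPoincare4-7488 · support · rank 9 · closed · proved by Summit.SmoothPoincare4.SmoothPoincare4.Theorems.RoundModel.roundModel @ d818e0a2e142 (prover) · by planner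
sources: Lee2013, Hirsch1976
[support] (sanity / non-vacuity of the shared hypothesis pattern) on the round S⁴ there are a smooth
embedding e : ℝ⁴ → S⁴ and F : S⁴ → ℝ⁴, a local diffeomorphism at every point outside e(B̊⁴) and
injective there, whose crease is the unit round sphere: e = inverse stereographic projection from
the north pole (unit sphere ↦ equator), F = stereographic projection from the south pole (junk value
at the south pole), F ∘ e = inversion u ↦ u/‖u‖² on the collar. A refuter who cannot build it has
found a definition leak in every item. [difficulty: provable-now] -/
@[route_item "route-SmoothPoincare4-EuclideanOrigami"]
def RoundModel : Prop :=
  ∃ (e : EuclideanSpace ℝ (Fin 4) → Metric.sphere (0 : EuclideanSpace ℝ (Fin 5)) 1) (F : (Metric.sphere (0 : EuclideanSpace ℝ (Fin 5)) 1) → EuclideanSpace ℝ (Fin 4)), Manifold.IsSmoothEmbedding (𝓡 4) (𝓡 4) ∞ e ∧ (∀ x, x ∉ e '' Metric.ball (0 : EuclideanSpace ℝ (Fin 4)) 1 → IsLocalDiffeomorphAt (𝓡 4) (𝓡 4) ∞ F x) ∧ Set.InjOn F (e '' Metric.ball (0 : EuclideanSpace ℝ (Fin 4)) 1)ᶜ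 ∧ ∀ u : EuclideanSpace ℝ (Fin 4), ‖u‖ = 1 → dist (F (e u)) 0 = 1

-- `RoundModel` holds: proved by `Summit.SmoothPoincare4.SmoothPoincare4.Theorems.RoundModel.roundModel` @ d818e0a2e142 (its module imports this route file, so no `_holds` link can be stated here).

-- earlier Assembly (stmt-SmoothPoincare4-7489, replaced 2026-08-15T16:20:04Z -> stmt-SmoothPoincare4-10646): retired by None — NoTripleRung → CreaseCollapse → Schoenflies → SchoenfliesGlue → Literature.Topology.FourManifolds.cerf_twistedSphere_four → SmoothPoincare4
/-- item stmt-SmoothPoincare4-10646 · assembly · rank 1 · open · by planner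
sources: Cerf1968, Palais1960, KervaireMilnor1963
[assembly] NoTripleRung → CreaseCollapse → Schoenflies → SchoenfliesGlue → SchsplitCerf →
SmoothPoincare4 (every antecedent a listed item of this route; Cerf Γ₄ = 0 enters through the
support item SchsplitCerf, verbatim the body of
`Literature.Topology.FourManifolds.cerf_twistedSphere_four`). PROVABLE NOW (bookkeeping):
CreaseCollapse gives for each (S, e) an immersed fake ball with triple-point-free crease,
NoTripleRung an injective immersion of Δ_e, SchoenfliesGlue (fed SchsplitCerf and Schoenflies) gives
∀ S : HomotopySphere 4, S ≅ S⁴, and `Literature.SPC4.smoothPoincare4_of_forall_homotopySphere`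
(Theorems/PICReduction.lean) with the proved facts `compactSpace_of_homotopyEquiv_sphere_four_holds`
/ `isOrientable_of_homotopyEquiv_sphere_four_holds` yields SmoothPoincare4. The route's deciding
theorem `closes` is `Assembly` applied to the items. Sources: Cerf1968, Palais1960,
KervaireMilnor1963. -/
@[route_item "route-SmoothPoincare4-EuclideanOrigami"]
def Assembly : Prop :=
  NoTripleRung → CreaseCollapse → Schoenflies → SchoenfliesGlue → SchsplitCerf → SmoothPoincare4

/-! D-0027 §2.1 — DECIDING THEOREM (planner-authored via `route open/edit --closes-file`; by planner-rbadge-SmoothPoincare4-EuclideanOrigam-9ba4878a-g4-0 2026-08-15T16:15:39Z):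
its hypotheses are this route's items and its conclusion the sub-problem Statement (glue_lint), and it elaborates with this file. -/

/-- D-0027 §2.1 deciding theorem of route EuclideanOrigami: the listed items imply `SmoothPoincare4`.
Pure logic. `Assembly` consumes the cruxes `NoTripleRung`, `CreaseCollapse`, `Schoenflies`, the support
`SchoenfliesGlue`, and Cerf's theorem `Γ₄ = 0` in twisted-sphere form, the latter supplied by the route's own
support item `SchsplitCerf` (verbatim the body of the named fact
`Literature.Topology.FourManifolds.cerf_twistedSphere_four`; accepted here by definitional unfolding, so no
unlisted Literature fact is assumed). The remaining items are hypotheses of the gate-generated target type and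
are not needed by the proof. -/
@[closes "route-SmoothPoincare4-EuclideanOrigami"] theorem closes (h₁ : NoTripleRung) (h₂ : CreaseCollapse) (h₃ : Schoenflies) (_h₄ : CoveringLemma)
    (_h₅ : RoundCreaseStandard) (h₆ : SchoenfliesGlue) (_h₇ : PuncturedEmbeds) (_h₈ : HirschPoenaruImmersion)
    (_h₉ : BoundaryDeterminesBall) (_h₁₀ : RoundModel) (h₁₁ : SchsplitCerf) (h₁₂ : Assembly) :
    _root_.SmoothPoincare4 :=
  h₁₂ h₁ h₂ h₃ h₆ h₁₁

end Summit.SmoothPoincare4.SmoothPoincare4.Theses.EuclideanOrigami
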